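import Summits.Ventures.PercRepro.RankLevelSetLevelSixHeavySq26Lo
import Summits.Ventures.PercRepro.RankLevelSetLevelSixHeavySq26Hi
import Summits.Ventures.PercRepro.RankLevelSetLevelSixHeavySq25S
import Summits.Ventures.PercRepro.RankLevelSetCoreSixLowSelfDI
import Summits.Ventures.PercRepro.RankLevelSetLevelSixHeavySq27All
import Summits.Ventures.PercRepro.S3SixWindow

/-!
# PercRepro — THEOREM C₆ AT RANK `26` BY THE COLOOP SPLIT: LEVEL `5` AT `25` ⇒ C-025 AT LEVEL `6` FOR EVERY `p ≥ 26` (p8 g7, S3)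

`proofs/SUBCLAIM-S3-p8.md` §3u (THE 26 ROW, on the nullity-4 cap 16). The core cells of rank `26`: at `7 ≤ d ≤ 14` by the COLOOP SPLIT — a core with no coloop by the coloop-free cells (`c025_core_six_bounded_corank_heavy_sq26_free`), a core with a coloop `e` by the scaled cell on `M ∖ e` (rank `26`, the same corank; `c025_core_six_scaled_heavy_sq25s` + `RLS_of_coloop_scaled`); at `15 ≤ d ≤ 51` by the cells `_lo` / `_hi`; at `d ≥ 52` by the corank regime `c025_core_six_thirtynine_twenty_six'` (RankLevelSetCoreSixLowSelfDI). Level `5` at `25` gives level `6` at `26` (`rls_six_at_of_core`); `p ≥ 27` is the `27` row `c025_six_large_twenty_seven` (RankLevelSetLevelSixHeavySq27All). Axioms: standard.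
-/

open scoped Matroid

namespace PercRepro

namespace ThmN

open Set

variable {α : Type}

/-- **The core cell `(26, d)` at `7 ≤ d ≤ 14`, every `e`-free core, by the coloop split.** -/
theorem c025_core_six_twentysix_small (M : Matroid α) [M.Finite] (d : ℕ) (hd7 : 7 ≤ d) (hd14 : d ≤ 14)
    (hR : M.eRank = (26 : ℕ∞)) (hn : M.E.ncard = 26 + d)
    (hfree : ∀ e ∈ M.E, ∃ A ⊆ M.E \ {e}, e ∉ M.closure A ∧ e ∉ M.closure ((M.E \ {e}) \ A)) :
    RLS M 26 6 := by
  by_cases hc : ∃ e ∈ M.E, M.IsColoop e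
  · obtain ⟨e, he, hce⟩ := hc
    have hR' : M.eRank = ((25 + 1 : ℕ) : ℕ∞) := by rw [hR]; norm_num
    have hR25 : (M ＼ {e}).eRank = ((25 : ℕ) : ℕ∞) := Matroid.eRank_delete_eq hce hR'
    have hn25 : (M ＼ {e}).E.ncard = 25 + d := by
      rw [Matroid.delete_singleton_ground, Set.ncard_sdiff_singleton_of_mem he, hn]
      omega
    exact RLS_of_coloop_scaled M hce (by norm_num) hR'
      (c025_core_six_scaled_heavy_sq25s (M ＼ {e}) 25 d (le_refl 25) hd7 hd14 hR25 hn25 (S1.hfree_delete M hfree e))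
  · have hcf : ∀ e ∈ M.E, ¬ M.IsColoop e := fun e he hce => hc ⟨e, he, hce⟩
    exact c025_core_six_bounded_corank_heavy_sq26_free M 26 d (le_refl 26) hd7 hd14 hcf hR hn hfree

/-- **The core cell `(26, d)` at every corank `d ≥ 7`, every `e`-free core.** -/
theorem c025_core_six_twentysix (M : Matroid α) [M.Finite] (d : ℕ) (hd7 : 7 ≤ d)
    (hR : M.eRank = (26 : ℕ∞)) (hn : M.E.ncard = 26 + d)
    (hfree : ∀ e ∈ M.E, ∃ A ⊆ M.E \ {e}, e ∉ M.closure A ∧ e ∉ M.closure ((M.E \ {e}) \ A)) :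
    RLS M 26 6 := by
  rcases Nat.lt_or_ge d 15 with h14 | h15
  · exact c025_core_six_twentysix_small M d hd7 (by omega) hR hn hfree
  rcases Nat.lt_or_ge d 32 with h31 | h32
  · exact c025_core_six_bounded_corank_heavy_sq26_lo M 26 d (le_refl 26) h15 (by omega) hR hn hfree
  rcases Nat.lt_or_ge d 52 with h51 | h52
  · exact c025_core_six_bounded_corank_heavy_sq26_hi M 26 d (le_refl 26) h32 (by omega) hR hn hfree
  · exact c025_core_six_thirtynine_twenty_six' M 26 (le_refl 26) hR (by omega) hfree

/-- **THEOREM C₆ AT RANK `26` BY THE COLOOP SPLIT, GIVEN LEVEL `5`**: level `5` for all `p ≥ 25` implies level `6` for all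
`p ≥ 26` (`p = 26` by the core cells above and `rls_six_at_of_core`; `p ≥ 27` by the `27` row). -/
theorem c025_six_of_five_heavy_sq26 (h5 : ∀ (M : Matroid α) [M.Finite] (p : ℕ), 25 ≤ p → RLS M p 5) :
    ∀ (M : Matroid α) [M.Finite] (p : ℕ), 26 ≤ p → RLS M p 6 := by
  intro M _ p hp
  rcases Nat.lt_or_ge p 27 with hlt | hge
  · have hP : p = 26 := by omega
    subst hP
    refine rls_six_at_of_core 26 (by norm_num) (fun M _ => h5 M 25 (by norm_num)) ?_ M
    intro M _ d hd hR hn hfree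
    exact c025_core_six_twentysix M d hd hR hn hfree
  · exact c025_six_large_twenty_seven M p hge
end ThmN

end PercRepro
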